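import Literature.MathematicalPhysics.QuantumFieldTheory.Balaban1983to89.B8Thm4Concrete
import Literature.MathematicalPhysics.QuantumFieldTheory.Balaban1983to89.B8Prop6CubeMember

/-!
# `Balaban1983to89.B8Prop6CubeMemberExists` — [Balaban1985RegularSpaces] THEOREM 4 (p. 88), EXISTENCE HALF, in the leaf's quantifier shape
# on the concrete `ℤᵈ × 𝔸` carriers with ONE uniform threshold and NO uniqueness socket; and **PROPOSITION 6** (p. 99) AT THE CONCRETE
# CUBE MEMBER `{□_j}` of (1.131) FROM IT — modulo the THREE EXISTENCE sockets only (Prop. 5 ∃ base ∕ ∃ step, [4] Thm 3.3 in Prop. 3's frame)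

statement-level skeleton of published theorems with citation tags; proofs where landed; nothing here is a claim about the
Yang–Mills mass gap

T. Bałaban, *Spaces of regular gauge field configurations on a lattice and gauge fixing conditions*, Commun. Math. Phys. **99**
(1985) 75–102 `[Balaban1985RegularSpaces]` ("B8"), Theorem 4 p. 88 (proof pp. 88–95), Proposition 6 p. 99 with (1.130)–(1.138) pp. 98–99.
PDF held: `paper:balaban1985-cmp99-regular-spaces-gauge-fixing` (journal page = PDF page + 74).

CITATION HEADER (lean-in-tree rule).  Cell `pub-ymgap` (YM Track A, HUMAN RULING D-0062), DAG node N05 = [B8], seat `pub-ymgap-dag-n05-c`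
(g2; director-ym R134 row «Thm 4 EXISTENCE half `Thm4ExistsBody cₑ`»; FAN-OUT §N05 s3b).  WHY THIS FILE.  Print's Proposition 6 is an
EXISTENCE statement — p. 99: *"If 7dL²Mα₀ ≤ c₁, then the assumptions of Theorem 4 are satisfied for the pair of configurations 1, U₀″,
thus there exists a gauge transformation u defined on □̃ and such that U₀^{w⁻¹} = U₁ … (1.135) … (1.136) … (1.137) … (1.138)"* — it
consumes ONLY the existence half of Theorem 4 (`B8.Thm4ExistsBody`; «exactly one» is Theorem 4's, not Proposition 6's, p. 88).  The
landed Proposition-6-at-the-cube-member modules (`B8Prop6CubeMember`, `B8Prop6CubeMemberFlat`, `B8SockHFPCubeMember` §3; this seat, g0) go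
through the FULL driver `B8Thm4Concrete.thm4Body_concrete_uniform` and therefore carry Proposition 5's UNIQUENESS socket (`SockP5u`, now
`SockP5uE`) — whose only provider in the tree, `B8SockP5uEAssembly.sockP5uE_body_of_join` (seat `pub-ymgap-dag-n04-b`), is stated on the
`Ω₀ = T_η` sub-family (`hΩ0 : Ω 0 = Set.univ`: every bond is touched, so the exponent is global), while the cube member has `Ω₀ = □₀`
(`B8CubeMemberIdxB8Laws.not_exists_idxB8_cubeMember`).  THIS FILE removes that socket where print never needed it:
* §1 **`thm4Exists_concrete_uniform`** — THEOREM 4, EXISTENCE HALF, on the concrete carriers in the leaf's quantifier shape, member-generic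
  (any `(Ω, Λs, Λb)` with the nesting (1.3) and the bond-class laws `hbox`∕`hclass`): ONE threshold `c₁(d, L, B₀, B₀′, cP) > 0`; for
  `α₀ + α₁ ≤ c₁` and every datum with (1.33), (1.34) (+ axial gauge at every truncation), (1.35) box form, (1.66)₀, THERE IS a unitary `u`,
  `= 1` off `Ω₀`, with (1.29) at `k` levels, `U′^{u⁻¹}` in the Landau gauge of record (1.38) (`k ≥ 1`) and of the (1.62)-shape
  `U′^{u⁻¹} = e^{iηA}`, `A = logCfg` Hermitian, `|A_b| ≤ 5dLB₀(α₀ + α₁)(Lʲη)⁻¹` on the sides touching `Ω_j` — MODULO THE THREE EXISTENCE SOCKETS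
  `SP5base`, `SP5`, `SH59` (verbatim the binders of `thm4Body_concrete_uniform`), NO `SP5u`, no radius `cu`, no `htower`∕`hpart`.  Proof = the
  existence half of `pub-ymgap-dag-n05-a`'s assembly verbatim (`B8Thm4Windows.thm4_windows`∕`_extra`, `B8Thm4SupportLocal.thm4_exists_all_levels_supp_landau138`,
  `B8Prop3GaugeFixedKLevel.logField_spec`).
* §2 **`prop6_exists_cubeMember₃`** — PROPOSITION 6 at the concrete cube member (`(Ω, Λs, Λb) := (cubeFam false, cubeLamS, cubeLamB)` of
  `B8CubeMemberZd`; background `1`, perturbation `U₀″ = B8Ineq133.cutFixed …`, `(α₀, α₁) ↦ (L³α₀, 6dL²Mα₀)` by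
  `B8Prop6CubeMember.thm4_hypotheses_one_cutFixed`) MODULO `SockP5base`∕`SockP5`∕`SockH59` at the member: g0's `prop6_exists_cubeMember`
  conclusion MINUS the uniqueness conjunct (∃ unitary `u` = 1 off `□₀`, (1.29), (1.38) of record, the (1.62)-shape with `logCfg`, `w = v⁻¹u`
  unitary, (1.135) on `□̃`); **`prop6_exists_cubeMember_of_HFP₃`** — the same in the knit's fixed-point currency `SockHFP₀`∕`SockHFP`∕`SockH59` at
  independent thresholds (`B8LeafModelZdOfHFP.windows4`, `sockP5base_of_sockHFP₀`, `sockP5_of_sockHFP`, antitonicity);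
  **`prop6_asPrinted_cubeMember_of_HFP₃`** — with EXACTLY print's hypotheses («let U₀, U₀′, □, □̃ be as described above, and let
  7dL²Mα₀ ≤ c₁», + print's implicit `L ≤ dM` and the (1.130)-step condition `11d < M`, G-B8-14) and print's constant `7dL²B₁Mα₀`, `B₁ = 5dLB₀`
  (`B8Prop6CubeMember.regime_of_printed_smallness`, `B8Prop6OfThm4.smallness_134`∕`const_136`).
NOT IN THIS FILE (dag-lead REBALANCE №54 (e)): the letters-fed corollary «`SockLetters` + `SB9all` ⇒ Proposition 6» waits for the range-form
re-type of `B8LeafModelZdSockLetters.SockLetters` (referee flag W8: its full-space `c_right` is unsatisfiable at members with finite `Ω₀`).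

HONEST SCOPE.  (i) MODULO the three existence sockets at the member (displayed hypotheses, object-bound: Prop. 5's contraction with the
letters of [4], [4] Thm 3.3); nothing of Propositions 3∕5, (1.42), (1.59) is proved here beyond composition BY NAME.  (ii) Of (1.136) only
the `|A|` member is concluded (the `∇`, `∂*∂`, `Δ` members are Proposition 3's at the member — `pub-ymgap-dag-n05-e`'s module 3); (1.137)'s
identity is `B8Prop6CubeMemberEq137` (n05-e), its inequality `B8Prop6OfThm4.ineq137_cube`.  (iii) «`u` defined on `□̃`» read as «`u` unitary on
`ℤᵈ`, `= 1` off `□₀ ⊂ □̃`»; `≤` where print has `<`; `T_η ↦ ℤᵈ`.  Count-neutral; N05 NOT discharged; one finite `T⁴` programme at fixed `ε`,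
Bałaban as printed — nothing continuum ∕ ℝ⁴ ∕ OS ∕ mass-gap ∕ Clay.  No `sorry`, no `axiom`, no `instance`, no `notation`.
Unit `pub-ymgap-dag-n05-c` (g2), 2026-08-26.

SCOPE NOTE (v-scope, 2026-08-27, seat pub-ymgap-dag-n05-c g11; director-ym LINE №196; NO statement change).  Every hypothesis of this file that is a
(1.59)-type socket read over the typed constraint-bond class `B8CubeMemberZd.cubeLamB` ∕ `B8IdxB8LawsB.towerBonds` (`SockH59`-, `SockB9P3`-shaped
binders: Theorem 4's ∕ Proposition 3's frame) is UNINHABITED at every nested member with `k ≥ 1` as soon as the socket is owed at the flat background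
`U₀ = 1` (interior shell gauge modes — kernel certificates `B8Ineq159FlatShellModeVacuity` p572834, `B8SockB9P3ShellModeVacuityUniv` p576185; root
cause: the class has no crossing bond, `B8Ineq159FlatCubeMemberPrinted.towerBonds_inner_of_printTower`).  The theorems below stay TRUE (PASS-AS-DECLARED) and
are VACUOUS wherever such a socket is among their hypotheses; the repaired class is `B8Ineq159FlatCubeMemberPrinted.cubeLamBP` (print's (1.31)∕[B6] (2.3)),
over which the consumers are being re-typed (edition γ).  Sockets over the SITE tower `cubeLamS` only (`SockHFP`, `SockP5u…`, the REAL families, the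
𝒢-bound) are NOT affected.

-/

noncomputable section

open NormedSpace

namespace Literature.MathematicalPhysics.QuantumFieldTheory.Balaban1983to89.B8Prop6CubeMemberExists

open Complex (I)
open MatrixLog B7Prop1Explicit B7Prop2Explicit B7Prop1Local B7Eq92Concrete B8Ineq130
open B7Prop2Explicit (C0 c2')
open B7Prop3Flat (c3)
open B8Ineq132 (covDerivFwd InAk InAxOne avgIter_one pdevOn_lt_of_inAk)
open B8Ineq133 (cutFixed)
open B8Eq115GaugeFixing (localGauge)
open B8Eq119TwistedAxial (Restr129 InAx)
open B8Eq184Proof (gaugeExp cfgExp)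
open B8Lemma1NonAbelian (mulCfg)
open B8Eq140Level (SideTouches)
open B8Eq146AExpansion (iEta)
open B7Prop4GeneralLevels (logCovIter linCovIter)
open B8Eq155JBound (Jcur wsup)
open B8ScaledSupNorm (bondNorm msup)
open B8Thm2LogB (blockTop)
open B8Eq138LandauZd (IsLandau138W logCfg)
open B8Prop3GaugeFixedKLevel (eq_mgauge_inv_of_mgauge_eq mem_unitaryUnits_of_mgauge_eq logField_spec)
open B8Thm4SupportLocal (thm4_exists_all_levels_supp_landau138)
open B8Thm4Windows (thm4_windows thm4_windows_extra)
open B8Thm4Concrete (mulCfg_eq_mul)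
open B8Eq131Cubes (cube tcube tLo tHi ctr tLo_le_tHi)
open B8Eq131CubesAdmissible (cubeFam)
open B8LeafModelZd (SockP5base SockP5 SockH59)
open B8LeafModelZdOfHFP (SockHFP₀ SockHFP sockP5base_of_sockHFP₀ sockP5_of_sockHFP sockH59_anti sockHFP₀_anti sockHFP_anti windows4)
open B8Prop6OfThm4 (localGauge_mem agree135 smallness_134 const_136)
open B8CubeMemberZd (cubeLamS cubeLamB hΩ_cubeFam hbox_cubeLamB hclass_cubeLamB)
open B8Prop6CubeMember (thm4_hypotheses_one_cutFixed regime_of_printed_smallness)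

-- `Site` alone could resolve to the torus sites of `Setup.lean`; re-export the `ℤ^d` sites of `B7Prop1Explicit`.
export B7Prop1Explicit (Site)

variable {d : ℕ}

/-! ## §1 Theorem 4, EXISTENCE HALF, on the concrete carriers — uniform threshold, three sockets, no uniqueness socket -/

section Thm4Exists

variable {𝔸 : Type*} [CStarAlgebra 𝔸] [Nontrivial 𝔸]

/-- **THEOREM 4 (p. 88), EXISTENCE HALF (`B8.Thm4ExistsBody`-shape), ON THE CONCRETE `ℤᵈ × 𝔸` CARRIERS, MEMBER-GENERIC, ONE UNIFORM
THRESHOLD** — «there is a positive constant c₁ … such that for arbitrary α₀, α₁ > 0, α₀ + α₁ ≤ c₁ and arbitrary configurations U₀,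
U′U₀ satisfying (1.33), (1.34), (1.66) … there exists [a] gauge transformation u satisfying (1.29) and such that the configuration
U₁ = U′^{u⁻¹} satisfies the conditions (1.37), (1.38) [and] (1.62)»: for the member `(Ω, Λs, Λb)` (nesting (1.3), bond-class laws
`hbox`∕`hclass`), ONE `c₁(d, L, B₀, B₀′, cP) > 0`; below it, for every datum, a unitary `u`, `= 1` off `Ω₀`, with (1.29) at `k` levels,
`U′^{u⁻¹}` in the Landau gauge of record (1.38) (`k ≥ 1`), `U′^{u⁻¹}_b = e^{iηA_b}` with `A = logCfg` Hermitian and `‖A_b‖ ≤ 5dLB₀(α₀ + α₁)(Lʲη)⁻¹`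
on the sides of the plaquettes touching `Ω_j`, `j ≤ k` — MODULO the three EXISTENCE sockets `SP5base`, `SP5`, `SH59` guarded by `cP`
(the binders of `B8Thm4Concrete.thm4Body_concrete_uniform` verbatim; NO uniqueness socket).  The existence half of
`pub-ymgap-dag-n05-a`'s assembly, verbatim. [cite: Balaban1985RegularSpaces, Thm 4 p.88, (1.29) p.81, (1.38) p.82, (1.62) p.87, Prop. 5 (1.107)–(1.108) p.94, (1.59) p.86, pp.94–95] -/
theorem thm4Exists_concrete_uniform (hd2 : 2 ≤ d) {L : ℕ} (hL : 2 ≤ L)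
    {B₀ B₀' cP : ℝ} (hB₀ : 0 < B₀) (hB₀' : 0 < B₀') (hB : 2 ≤ 5 * (d : ℝ) * L * B₀) (hcP : 0 < cP) :
    ∃ c₁ : ℝ, 0 < c₁ ∧ ∀ (η : ℝ), 0 < η → ∀ (k : ℕ)
    (Ω : ℕ → Set (Site d)) (hΩ : ∀ j, Ω (j + 1) ⊆ Ω j) (Λs : ℕ → ℕ → Set (Site d)) (Λb : ℕ → ℕ → Set (Site d × Fin d))
    (hbox : ∀ m, m ≤ k → ∀ j, j ≤ m → ∀ c ∈ Λb m j, ∀ x, InBox (loK L j c.1) (bondHiK L j c.1 c.2) x → x ∈ Ω j)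
    (hclass : ∀ m, m ≤ k → ∀ j, j ≤ m → ∀ c ∈ Λb m j,
      (c.1 ∈ Λs m j ∧ c.1 + e c.2 ∈ Λs m j) ∨
      (∃ j', j = j' + 1 ∧ (∀ x, (L : ℤ) • c.1 ≤ x → x ≤ (L : ℤ) • c.1 + blockTop L → x ∈ Λs m j') ∧ c.1 + e c.2 ∈ Λs m j) ∨
      (∃ j', j = j' + 1 ∧ c.1 ∈ Λs m j ∧ (∀ x, (L : ℤ) • (c.1 + e c.2) ≤ x → x ≤ (L : ℤ) • (c.1 + e c.2) + blockTop L → x ∈ Λs m j')))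
    (SP5base : ∀ α₀ α₁ : ℝ, 0 < α₀ → 0 < α₁ → α₀ + α₁ ≤ cP →
      ∀ U₀ U' : Site d → Fin d → 𝔸ˣ, (∀ x κ, U₀ x κ ∈ unitaryUnits 𝔸) → (∀ x κ, U' x κ ∈ unitaryUnits 𝔸) →
      InAk L k η α₀ Ω U₀ → InAk L k η α₀ Ω (mulCfg U' U₀) → (∀ m, m ≤ k → InAx L m (Λs m) U₀ (mulCfg U' U₀)) →
      (∀ j, j ≤ k → ∀ (z : Site d) (μ : Fin d), (∀ x, InBox (loK L j z) (bondHiK L j z μ) x → x ∈ Ω j) →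
        ‖(avgIter L (mulCfg U' U₀) j z μ : 𝔸) - (avgIter L U₀ j z μ : 𝔸)‖ ≤ α₁) →
      (∀ b ∈ {b : Site d × Fin d | SideTouches (Ω 0) b.1 b.2}, ‖((U' b.1 b.2 : 𝔸ˣ) : 𝔸) - 1‖ ≤ α₁) →
      (∃ (v : Site d → 𝔸ˣ) (lam : Site d → 𝔸), (∀ x, v x ∈ unitaryUnits 𝔸) ∧ (∀ x, x ∉ Ω 0 → v x = 1) ∧
        (∀ j, j ≤ 1 → ∀ b ∈ {b : Site d × Fin d | SideTouches (Ω j) b.1 b.2}, (v b.1 : 𝔸) = ((gaugeExp lam b.1 : 𝔸ˣ) : 𝔸) ∧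
        (v (b.1 + e b.2) : 𝔸) = ((gaugeExp lam (b.1 + e b.2) : 𝔸ˣ) : 𝔸)) ∧
        (∀ j, j ≤ 1 → ∀ b ∈ {b : Site d × Fin d | SideTouches (Ω j) b.1 b.2},
        ‖lam b.1‖ ≤ (8 * B₀' * (5 * (d : ℝ) * L * B₀) * (α₀ + α₁)) ∧ ((L : ℝ) ^ j * η) * ‖covDerivFwd η U₀ b.2 lam b.1‖ ≤ (8 * B₀' * (5 * (d : ℝ) * L * B₀) * (α₀ + α₁))) ∧
        IsLandau138W L 1 η (Ω 0) (Λs 1) U₀ (mgauge U₀ v⁻¹ U') ∧ Restr129 L 1 (Λs 1) U₀ ((1 : Site d → 𝔸ˣ) * v)))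
    (SP5 : ∀ α₀ α₁ : ℝ, 0 < α₀ → 0 < α₁ → α₀ + α₁ ≤ cP →
      ∀ U₀ U' : Site d → Fin d → 𝔸ˣ, (∀ x κ, U₀ x κ ∈ unitaryUnits 𝔸) → (∀ x κ, U' x κ ∈ unitaryUnits 𝔸) →
      InAk L k η α₀ Ω U₀ → InAk L k η α₀ Ω (mulCfg U' U₀) → (∀ m, m ≤ k → InAx L m (Λs m) U₀ (mulCfg U' U₀)) →
      (∀ j, j ≤ k → ∀ (z : Site d) (μ : Fin d), (∀ x, InBox (loK L j z) (bondHiK L j z μ) x → x ∈ Ω j) →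
        ‖(avgIter L (mulCfg U' U₀) j z μ : 𝔸) - (avgIter L U₀ j z μ : 𝔸)‖ ≤ α₁) →
      (∀ b ∈ {b : Site d × Fin d | SideTouches (Ω 0) b.1 b.2}, ‖((U' b.1 b.2 : 𝔸ˣ) : 𝔸) - 1‖ ≤ α₁) →
      (∀ m, 1 ≤ m → m < k → ∀ (u₁ : Site d → 𝔸ˣ) (U₁ : Site d → Fin d → 𝔸ˣ) (A : Site d → Fin d → 𝔸),
        (∀ x, u₁ x ∈ unitaryUnits 𝔸) → (∀ x, x ∉ Ω 0 → u₁ x = 1) → mgauge U₀ u₁ U₁ = U' → Restr129 L m (Λs m) U₀ u₁ →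
        IsLandau138W L m η (Ω 0) (Λs m) U₀ U₁ →
        (∀ j, j ≤ m → ∀ b ∈ {b : Site d × Fin d | SideTouches (Ω j) b.1 b.2},
        U₁ b.1 b.2 = cfgExp η A b.1 b.2 ∧ IsSelfAdjoint (A b.1 b.2) ∧ ‖A b.1 b.2‖ ≤ (5 * (d : ℝ) * L * B₀ * (α₀ + α₁)) * ((L : ℝ) ^ j * η)⁻¹) →
        ∃ (v : Site d → 𝔸ˣ) (lam : Site d → 𝔸), (∀ x, v x ∈ unitaryUnits 𝔸) ∧ (∀ x, x ∉ Ω 0 → v x = 1) ∧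
        (∀ j, j ≤ m + 1 → ∀ b ∈ {b : Site d × Fin d | SideTouches (Ω j) b.1 b.2}, (v b.1 : 𝔸) = ((gaugeExp lam b.1 : 𝔸ˣ) : 𝔸) ∧
        (v (b.1 + e b.2) : 𝔸) = ((gaugeExp lam (b.1 + e b.2) : 𝔸ˣ) : 𝔸)) ∧
        (∀ j, j ≤ m + 1 → ∀ b ∈ {b : Site d × Fin d | SideTouches (Ω j) b.1 b.2},
        ‖lam b.1‖ ≤ (8 * B₀' * (5 * (d : ℝ) * L * B₀) * (α₀ + α₁)) ∧ ((L : ℝ) ^ j * η) * ‖covDerivFwd η U₀ b.2 lam b.1‖ ≤ (8 * B₀' * (5 * (d : ℝ) * L * B₀) * (α₀ + α₁))) ∧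
        IsLandau138W L (m + 1) η (Ω 0) (Λs (m + 1)) U₀ (mgauge U₀ v⁻¹ U₁) ∧ Restr129 L (m + 1) (Λs (m + 1)) U₀ (u₁ * v)))
    (SH59 : ∀ α₀ α₁ : ℝ, 0 < α₀ → 0 < α₁ → α₀ + α₁ ≤ cP →
      ∀ U₀ U' : Site d → Fin d → 𝔸ˣ, (∀ x κ, U₀ x κ ∈ unitaryUnits 𝔸) → (∀ x κ, U' x κ ∈ unitaryUnits 𝔸) →
      InAk L k η α₀ Ω U₀ → InAk L k η α₀ Ω (mulCfg U' U₀) → (∀ m, m ≤ k → InAx L m (Λs m) U₀ (mulCfg U' U₀)) →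
      (∀ j, j ≤ k → ∀ (z : Site d) (μ : Fin d), (∀ x, InBox (loK L j z) (bondHiK L j z μ) x → x ∈ Ω j) →
        ‖(avgIter L (mulCfg U' U₀) j z μ : 𝔸) - (avgIter L U₀ j z μ : 𝔸)‖ ≤ α₁) →
      (∀ b ∈ {b : Site d × Fin d | SideTouches (Ω 0) b.1 b.2}, ‖((U' b.1 b.2 : 𝔸ˣ) : 𝔸) - 1‖ ≤ α₁) →
      (∀ m, 1 ≤ m → m ≤ k → ∀ (u : Site d → 𝔸ˣ) (W : Site d → Fin d → 𝔸ˣ) (A' : Site d → Fin d → 𝔸),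
        (∀ x, u x ∈ unitaryUnits 𝔸) → mgauge U₀ u W = U' → Restr129 L m (Λs m) U₀ u → IsLandau138W L m η (Ω 0) (Λs m) U₀ W →
        (∀ y τ, IsSelfAdjoint (A' y τ)) →
        (∀ j, j ≤ m → ∀ y τ, SideTouches (Ω j) y τ →
        W y τ = cfgExp η A' y τ ∧ ‖A' y τ‖ ≤ (2 * (L * (5 * (d : ℝ) * L * B₀ * (α₀ + α₁))) + 8 * (8 * B₀' * (5 * (d : ℝ) * L * B₀) * (α₀ + α₁))) * ((L : ℝ) ^ j * η)⁻¹) →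
        (∀ y τ, (∀ j, j ≤ m → ¬ SideTouches (Ω j) y τ) → A' y τ = 0) →
        msup L m η (-(1 : ℝ)) (fun j (b : Site d × Fin d) => SideTouches (Ω j) b.1 b.2) (fun b => A' b.1 b.2)
        ≤ B₀ * (bondNorm L m η (-(3 : ℝ)) Ω (fun x μ => Jcur η U₀ A' μ x)
        + wsup 1 (fun p : {p : ℕ × (Site d × Fin d) // p.1 ≤ m ∧ p.2 ∈ Λb m p.1} =>
        linCovIter L U₀ (iEta η A') p.1.1 p.1.2.1 p.1.2.2)) ∧
        msup L m η (-(2 : ℝ)) (fun j (t : Fin d × Fin d × Site d) => SideTouches (Ω j) t.2.2 t.2.1)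
        (fun t => covDerivFwd η U₀ t.1 (fun z => A' z t.2.1) t.2.2)
        ≤ B₀ * (bondNorm L m η (-(3 : ℝ)) Ω (fun x μ => Jcur η U₀ A' μ x)
        + wsup 1 (fun p : {p : ℕ × (Site d × Fin d) // p.1 ≤ m ∧ p.2 ∈ Λb m p.1} =>
        linCovIter L U₀ (iEta η A') p.1.1 p.1.2.1 p.1.2.2)))),
      ∀ α₀ α₁ : ℝ, 0 < α₀ → 0 < α₁ → α₀ + α₁ ≤ c₁ →
      ∀ U₀ U' : Site d → Fin d → 𝔸ˣ, (∀ x κ, U₀ x κ ∈ unitaryUnits 𝔸) → (∀ x κ, U' x κ ∈ unitaryUnits 𝔸) →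
      InAk L k η α₀ Ω U₀ → InAk L k η α₀ Ω (mulCfg U' U₀) → (∀ m, m ≤ k → InAx L m (Λs m) U₀ (mulCfg U' U₀)) →
      (∀ j, j ≤ k → ∀ (z : Site d) (μ : Fin d), (∀ x, InBox (loK L j z) (bondHiK L j z μ) x → x ∈ Ω j) →
        ‖(avgIter L (mulCfg U' U₀) j z μ : 𝔸) - (avgIter L U₀ j z μ : 𝔸)‖ ≤ α₁) →
      (∀ b ∈ {b : Site d × Fin d | SideTouches (Ω 0) b.1 b.2}, ‖((U' b.1 b.2 : 𝔸ˣ) : 𝔸) - 1‖ ≤ α₁) →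
      ∃ u : Site d → 𝔸ˣ, (∀ x, u x ∈ unitaryUnits 𝔸) ∧ (∀ x, x ∉ Ω 0 → u x = 1) ∧ Restr129 L k (Λs k) U₀ u ∧
        (1 ≤ k → IsLandau138W L k η (Ω 0) (Λs k) U₀ (mgauge U₀ u⁻¹ U')) ∧
        (∀ j, j ≤ k → ∀ b ∈ {b : Site d × Fin d | SideTouches (Ω j) b.1 b.2},
          mgauge U₀ u⁻¹ U' b.1 b.2 = cfgExp η (logCfg η (mgauge U₀ u⁻¹ U')) b.1 b.2 ∧
            IsSelfAdjoint (logCfg η (mgauge U₀ u⁻¹ U') b.1 b.2) ∧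
            ‖logCfg η (mgauge U₀ u⁻¹ U') b.1 b.2‖ ≤ (5 * (d : ℝ) * L * B₀ * (α₀ + α₁)) * ((L : ℝ) ^ j * η)⁻¹) := by
  have hL1 : 1 ≤ L := le_trans (by norm_num) hL
  have hd1 : 1 ≤ d := le_trans (by norm_num) hd2
  have hL' : (1 : ℝ) ≤ L := by exact_mod_cast hL1
  obtain ⟨c₁, hc₁, hw⟩ := thm4_windows hd1 hL1 hB₀ hB₀' hB
  obtain ⟨c₂, hc₂, hw'⟩ := thm4_windows_extra (d := d) hL1
  refine ⟨min (min c₁ c₂) cP, lt_min (lt_min hc₁ hc₂) hcP, ?_⟩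
  intro η hη k Ω hΩ Λs Λb hbox hclass SP5base SP5 SH59 α₀ α₁ hα₀ hα₁ hS U₀ U' hU₀ hU' h33 h34 hAx h135 h66
  have hS1 : α₀ + α₁ ≤ c₁ := hS.trans ((min_le_left _ _).trans (min_le_left _ _))
  have hS2 : α₀ + α₁ ≤ c₂ := hS.trans ((min_le_left _ _).trans (min_le_right _ _))
  have hSP : α₀ + α₁ ≤ cP := hS.trans (min_le_right _ _)
  obtain ⟨w1, w2, w3, w4, w5, w6, w7, w8, w9, w10, w11, w12, w13, w14, -⟩ :=
    hw α₀ α₁ hα₀ hα₁ hS1 (5 * (d : ℝ) * L * B₀ * (α₀ + α₁)) (8 * B₀' * (5 * (d : ℝ) * L * B₀) * (α₀ + α₁)) rfl rfl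
  obtain ⟨w19, -⟩ := hw' α₀ α₁ hα₀ hα₁ hS2
  have hcs0 : 0 ≤ 5 * (d : ℝ) * L * B₀ * (α₀ + α₁) := by positivity
  have hα₄0 : 0 ≤ 8 * B₀' * (5 * (d : ℝ) * L * B₀) * (α₀ + α₁) := by positivity
  -- EXISTENCE (support form) at the top level `k`
  obtain ⟨u, hu, huS, h129, W, hW, hLan, A, hA⟩ := thm4_exists_all_levels_supp_landau138 hd2 hη hL k hU₀ hU' hα₀ hα₁ hα₄0 hB₀.le
    rfl w1 w2 w3 w4 w5 w6 w7 w8 w9 w10 w11 w12 w19 w13 w14 Ω hΩ Λs Λb hbox hclass h33 h34 hAx h135 h66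
    (SP5base α₀ α₁ hα₀ hα₁ hSP U₀ U' hU₀ hU' h33 h34 hAx h135 h66) (SP5 α₀ α₁ hα₀ hα₁ hSP U₀ U' hU₀ hU' h33 h34 hAx h135 h66)
    (SH59 α₀ α₁ hα₀ hα₁ hSP U₀ U' hU₀ hU' h33 h34 hAx h135 h66) k le_rfl
  have hWeq : W = mgauge U₀ u⁻¹ U' := eq_mgauge_inv_of_mgauge_eq hW
  have hWu : ∀ x κ, W x κ ∈ unitaryUnits 𝔸 := mem_unitaryUnits_of_mgauge_eq hU₀ hU' hu hW
  -- `c⋆ ≤ 1/16` for the logarithm device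
  have hc16 : 5 * (d : ℝ) * L * B₀ * (α₀ + α₁) ≤ 1 / 16 := by
    have h₁ : (1 : ℝ) * (5 * (d : ℝ) * L * B₀ * (α₀ + α₁)) ≤ L * (5 * (d : ℝ) * L * B₀ * (α₀ + α₁)) :=
      mul_le_mul_of_nonneg_right hL' hcs0
    linarith
  -- the exponent read back as `logCfg`
  have hleaf : ∀ j, j ≤ k → ∀ b ∈ {b : Site d × Fin d | SideTouches (Ω j) b.1 b.2},
      mgauge U₀ u⁻¹ U' b.1 b.2 = cfgExp η (logCfg η (mgauge U₀ u⁻¹ U')) b.1 b.2 ∧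
        IsSelfAdjoint (logCfg η (mgauge U₀ u⁻¹ U') b.1 b.2) ∧
        ‖logCfg η (mgauge U₀ u⁻¹ U') b.1 b.2‖ ≤ (5 * (d : ℝ) * L * B₀ * (α₀ + α₁)) * ((L : ℝ) ^ j * η)⁻¹ := by
    intro j hj b hb
    obtain ⟨hexp, -, hbd⟩ := hA j hj b hb
    have hbd' : ‖A b.1 b.2‖ ≤ (5 * (d : ℝ) * L * B₀ * (α₀ + α₁)) * η⁻¹ := by
      refine hbd.trans ?_
      have hLj : (1 : ℝ) ≤ (L : ℝ) ^ j := one_le_pow₀ hL'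
      have : ((L : ℝ) ^ j * η)⁻¹ ≤ η⁻¹ := by
        rw [mul_inv]
        calc ((L : ℝ) ^ j)⁻¹ * η⁻¹ ≤ 1 * η⁻¹ := by gcongr; exact inv_le_one_of_one_le₀ hLj
          _ = η⁻¹ := one_mul _
      exact mul_le_mul_of_nonneg_left this hcs0
    obtain ⟨hlogA, hsa, hWexp⟩ := logField_spec hη U₀ hWu hexp hbd' hc16
    rw [← hWeq]
    refine ⟨hWexp, ?_, ?_⟩
    · simpa [logCfg] using hsa
    · show ‖logCfg η W b.1 b.2‖ ≤ _
      rw [logCfg, hlogA]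
      exact hbd
  exact ⟨u, hu, huS, h129, fun hk => hWeq ▸ hLan hk, hleaf⟩

end Thm4Exists

/-! ## §2 PROPOSITION 6 at the concrete cube member from the existence half — three sockets, no uniqueness socket -/

section Prop6

variable {𝔸 : Type} [CStarAlgebra 𝔸] [Nontrivial 𝔸]

/-- **PROPOSITION 6 (p. 99) AT THE CONCRETE CUBE MEMBER, MODULO THE THREE EXISTENCE SOCKETS** («the assumptions of Theorem 4 are satisfied for
the pair of configurations 1, U₀″, thus there exists a gauge transformation u such that U₁ = U₀″^{u⁻¹} satisfies the conditions …»; Theorem 4 =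
§1's existence-only driver at `U₀ := 1`, `U′ := U₀″`, `Ω_j := □_j`, `Λs := cubeLamS`, `Λb := cubeLamB`).  ONE threshold `c₁(d, L, B₀, B₀′, cP) > 0`;
for every cube datum `(η > 0, k ≥ 1, a, L ≤ ρ ≤ M, 11d < M)` at which the three sockets hold, every unitary-valued `U₀ ∈ 𝔄_k({Ω_j}, α₀)` with
`□̃ ⊂ Ω_{k−1}` in the regime of (1.130), and `L³α₀ + 6dL²Mα₀ ≤ c₁`: THERE IS a unitary `u`, `= 1` off `□₀`, with (1.29) w.r.t. `cubeLamS … k`,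
such that `U₁ := U₀″^{u⁻¹}` satisfies (1.38) of record (`IsLandau138W`) and (1.62): `U₁ = e^{iηA}`, `A` Hermitian,
`|A_b| ≤ 5dLB₀(L³α₀ + 6dL²Mα₀)(Lʲη)⁻¹` on the bonds of the plaquettes touching `□_j` (`j ≤ k`); and (1.135): `w := v⁻¹u` is unitary and
`U₀^{w⁻¹} = U₁` on the bonds of `□̃`, `v` = the gauge transformation `U₀ ↦ U₀′` of p. 98.  This is `B8Prop6CubeMember.prop6_exists_cubeMember`
WITHOUT the uniqueness socket and without the uniqueness conjunct (print's Proposition 6 asserts existence only).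
[cite: Balaban1985RegularSpaces, Prop. 6 (1.135)–(1.136) p.99, p.99 (sentence after (1.133)), Thm 4 p.88, (1.29) p.81, (1.38) p.82, (1.62) p.87] -/
theorem prop6_exists_cubeMember₃ (hd2 : 2 ≤ d) {L : ℕ} (hL : 2 ≤ L) {B₀ B₀' cP : ℝ} (hB₀ : 0 < B₀) (hB₀' : 0 < B₀')
    (hB : 2 ≤ 5 * (d : ℝ) * L * B₀) (hcP : 0 < cP) :
    ∃ c₁ : ℝ, 0 < c₁ ∧ ∀ (η : ℝ), 0 < η → ∀ (k : ℕ), 1 ≤ k → ∀ (a : Site d) (M ρ : ℕ), L ≤ ρ → ρ ≤ M → 11 * (d : ℝ) < M →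
      SockP5base (𝔸 := 𝔸) L B₀ B₀' cP η k (cubeFam false L a M ρ k) (cubeLamS L a M ρ k) →
      SockP5 (𝔸 := 𝔸) L B₀ B₀' cP η k (cubeFam false L a M ρ k) (cubeLamS L a M ρ k) →
      SockH59 (𝔸 := 𝔸) L B₀ B₀' cP η k (cubeFam false L a M ρ k) (cubeLamS L a M ρ k) (cubeLamB L a M ρ k) →
      ∀ (U₀ : Site d → Fin d → 𝔸ˣ), (∀ x κ, U₀ x κ ∈ unitaryUnits 𝔸) → ∀ (α₀ : ℝ), 0 < α₀ →
      C0 d * (α₀ * (L : ℝ) ^ 2) ≤ 1 / 3 → 2 * (α₀ * (L : ℝ) ^ 2) ≤ c2' d L →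
      ∀ (Ω : ℕ → Set (Site d)), InAk L k η α₀ Ω U₀ → tcube L a M ρ k ⊆ Ω (k - 1) →
      11 * (d : ℝ) ^ 2 * (L : ℝ) ^ 2 * α₀ + ((M : ℝ) + 4 * ρ) * d * (L : ℝ) ^ 2 * α₀ ≤ 1 / 6 →
      (L : ℝ) ^ 3 * α₀ + 6 * d * (L : ℝ) ^ 2 * M * α₀ ≤ c₁ →
      ∃ u : Site d → 𝔸ˣ, (∀ x, u x ∈ unitaryUnits 𝔸) ∧ (∀ x, x ∉ cubeFam false L a M ρ k 0 → u x = 1) ∧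
        Restr129 L k (cubeLamS L a M ρ k k) (1 : Site d → Fin d → 𝔸ˣ) u ∧
        IsLandau138W L k η (cubeFam false L a M ρ k 0) (cubeLamS L a M ρ k k) (1 : Site d → Fin d → 𝔸ˣ)
          (gaugeAct u⁻¹ (cutFixed L (tLo a ρ) (tHi a M ρ) U₀ k (ctr a M))) ∧
        (∀ j, j ≤ k → ∀ b ∈ {b : Site d × Fin d | SideTouches (cubeFam false L a M ρ k j) b.1 b.2},
          gaugeAct u⁻¹ (cutFixed L (tLo a ρ) (tHi a M ρ) U₀ k (ctr a M)) b.1 b.2 =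
              cfgExp η (logCfg η (gaugeAct u⁻¹ (cutFixed L (tLo a ρ) (tHi a M ρ) U₀ k (ctr a M)))) b.1 b.2 ∧
            IsSelfAdjoint (logCfg η (gaugeAct u⁻¹ (cutFixed L (tLo a ρ) (tHi a M ρ) U₀ k (ctr a M))) b.1 b.2) ∧
            ‖logCfg η (gaugeAct u⁻¹ (cutFixed L (tLo a ρ) (tHi a M ρ) U₀ k (ctr a M))) b.1 b.2‖ ≤
              (5 * (d : ℝ) * L * B₀ * ((L : ℝ) ^ 3 * α₀ + 6 * d * (L : ℝ) ^ 2 * M * α₀)) * ((L : ℝ) ^ j * η)⁻¹) ∧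
        (∀ x, ((localGauge L (tLo a ρ) (tHi a M ρ) U₀ k (ctr a M))⁻¹ * u) x ∈ unitaryUnits 𝔸) ∧
        AgreeOn (tlo L (tLo a ρ) k) (thi L (tHi a M ρ) k)
          (gaugeAct ((localGauge L (tLo a ρ) (tHi a M ρ) U₀ k (ctr a M))⁻¹ * u)⁻¹ U₀)
          (gaugeAct u⁻¹ (cutFixed L (tLo a ρ) (tHi a M ρ) U₀ k (ctr a M))) := by
  have hL1 : 1 ≤ L := le_trans (by norm_num) hL
  have hd1 : 1 ≤ d := le_trans (by norm_num) hd2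
  have hLpos : (0 : ℝ) < L := by exact_mod_cast lt_of_lt_of_le (by norm_num) hL
  have hdpos : (0 : ℝ) < d := by exact_mod_cast hd1
  obtain ⟨c₁, hc₁, H⟩ := thm4Exists_concrete_uniform (𝔸 := 𝔸) hd2 hL hB₀ hB₀' hB hcP
  refine ⟨c₁, hc₁, ?_⟩
  intro η hη k hk a M ρ hρL hρM hM SP5base SP5 SH59 U₀ hU₀ α₀ hα hα3 hα2 Ω hA hT hsmall hc
  have hρ : 1 ≤ ρ := hL1.trans hρL
  have hM1 : 1 ≤ M := hρ.trans hρM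
  have hMpos : (0 : ℝ) < M := by exact_mod_cast hM1
  have hα₀' : 0 < (L : ℝ) ^ 3 * α₀ := by positivity
  have hα₁' : 0 < 6 * (d : ℝ) * (L : ℝ) ^ 2 * M * α₀ := by positivity
  obtain ⟨hmem, h33, h34, hAx, h135, h66⟩ :=
    thm4_hypotheses_one_cutFixed L hL hd1 k U₀ hU₀ hα hα3 hα2 a hρ hρM hM hη hA hT hsmall
  have hone : ∀ x κ, (1 : Site d → Fin d → 𝔸ˣ) x κ ∈ unitaryUnits 𝔸 := fun _ _ => (unitaryUnits 𝔸).one_mem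
  obtain ⟨u, hu, huS, h129, hLan, h162⟩ := H η hη k (cubeFam false L a M ρ k) (hΩ_cubeFam hL1 a M hρL k)
    (cubeLamS L a M ρ k) (cubeLamB L a M ρ k) (hbox_cubeLamB L a M ρ k) (hclass_cubeLamB L a M ρ k)
    SP5base SP5 SH59 _ _ hα₀' hα₁' hc 1 _ hone hmem h33 h34 hAx h135 h66
  simp only [mgauge_one_left] at hLan h162
  -- the gauge transformation `v` of p. 98 is unitary ((1.7) on `□̃` alone)
  have hΩ' : ∃ l, l ≤ k ∧ k ≤ l + 1 ∧ ∀ x, InBox (tlo L (tLo a ρ) k) (thi L (tHi a M ρ) k) x → x ∈ Ω l :=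
    ⟨k - 1, Nat.sub_le _ _, by omega, fun x hx => hT hx⟩
  have hvG : ∀ x, localGauge L (tLo a ρ) (tHi a M ρ) U₀ k (ctr a M) x ∈ unitaryUnits 𝔸 :=
    localGauge_mem L hL (avgClosed_unitaryUnits (𝔸 := 𝔸) d L) k U₀ hU₀ hα hα3 hα2 (tLo_le_tHi hM1)
      (pdevOn_lt_of_inAk hL1 hα hA hΩ') (ctr a M)
  exact ⟨u, hu, huS, h129, hLan hk, h162,
    fun x => (unitaryUnits 𝔸).mul_mem ((unitaryUnits 𝔸).inv_mem (hvG x)) (hu x), agree135 _ _ U₀ _ u⟩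

/-- **§2 IN THE KNIT'S FIXED-POINT CURRENCY, THREE INDEPENDENT THRESHOLDS**: `prop6_exists_cubeMember₃` with the two Proposition-5 existence
sockets as `B8LeafModelZdOfHFP.SockHFP₀`∕`SockHFP` (the output currency of the contraction ∕ the letters-fed assemblies) and `SockH59`, at their own
thresholds `cF₀, cF, c59` — reduced to `prop6_exists_cubeMember₃` below the `min` of the three and the window threshold of `windows4` (adapters
`sockP5base_of_sockHFP₀`, `sockP5_of_sockHFP`, antitonicity), exactly as `B8Prop6CubeMember.prop6_exists_cubeMember_of_HFP₄` but WITHOUT the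
uniqueness socket. [cite: Balaban1985RegularSpaces, Prop. 6 p.99, Prop. 5 (1.106)–(1.108) p.94, (1.59) p.86] -/
theorem prop6_exists_cubeMember_of_HFP₃ (hd2 : 2 ≤ d) {L : ℕ} (hL : 2 ≤ L) {B₀ B₀' cF₀ cF c59 : ℝ} (hB₀ : 0 < B₀)
    (hB₀' : 0 < B₀') (hB : 2 ≤ 5 * (d : ℝ) * L * B₀) (hcF₀ : 0 < cF₀) (hcF : 0 < cF) (hc59 : 0 < c59) :
    ∃ c₁ : ℝ, 0 < c₁ ∧ ∀ (η : ℝ), 0 < η → ∀ (k : ℕ), 1 ≤ k → ∀ (a : Site d) (M ρ : ℕ), L ≤ ρ → ρ ≤ M → 11 * (d : ℝ) < M →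
      SockHFP₀ (𝔸 := 𝔸) L B₀ B₀' cF₀ η k (cubeFam false L a M ρ k) (cubeLamS L a M ρ k) →
      SockHFP (𝔸 := 𝔸) L B₀ B₀' cF η k (cubeFam false L a M ρ k) (cubeLamS L a M ρ k) →
      SockH59 (𝔸 := 𝔸) L B₀ B₀' c59 η k (cubeFam false L a M ρ k) (cubeLamS L a M ρ k) (cubeLamB L a M ρ k) →
      ∀ (U₀ : Site d → Fin d → 𝔸ˣ), (∀ x κ, U₀ x κ ∈ unitaryUnits 𝔸) → ∀ (α₀ : ℝ), 0 < α₀ →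
      C0 d * (α₀ * (L : ℝ) ^ 2) ≤ 1 / 3 → 2 * (α₀ * (L : ℝ) ^ 2) ≤ c2' d L →
      ∀ (Ω : ℕ → Set (Site d)), InAk L k η α₀ Ω U₀ → tcube L a M ρ k ⊆ Ω (k - 1) →
      11 * (d : ℝ) ^ 2 * (L : ℝ) ^ 2 * α₀ + ((M : ℝ) + 4 * ρ) * d * (L : ℝ) ^ 2 * α₀ ≤ 1 / 6 →
      (L : ℝ) ^ 3 * α₀ + 6 * d * (L : ℝ) ^ 2 * M * α₀ ≤ c₁ →
      ∃ u : Site d → 𝔸ˣ, (∀ x, u x ∈ unitaryUnits 𝔸) ∧ (∀ x, x ∉ cubeFam false L a M ρ k 0 → u x = 1) ∧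
        Restr129 L k (cubeLamS L a M ρ k k) (1 : Site d → Fin d → 𝔸ˣ) u ∧
        IsLandau138W L k η (cubeFam false L a M ρ k 0) (cubeLamS L a M ρ k k) (1 : Site d → Fin d → 𝔸ˣ)
          (gaugeAct u⁻¹ (cutFixed L (tLo a ρ) (tHi a M ρ) U₀ k (ctr a M))) ∧
        (∀ j, j ≤ k → ∀ b ∈ {b : Site d × Fin d | SideTouches (cubeFam false L a M ρ k j) b.1 b.2},
          gaugeAct u⁻¹ (cutFixed L (tLo a ρ) (tHi a M ρ) U₀ k (ctr a M)) b.1 b.2 =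
              cfgExp η (logCfg η (gaugeAct u⁻¹ (cutFixed L (tLo a ρ) (tHi a M ρ) U₀ k (ctr a M)))) b.1 b.2 ∧
            IsSelfAdjoint (logCfg η (gaugeAct u⁻¹ (cutFixed L (tLo a ρ) (tHi a M ρ) U₀ k (ctr a M))) b.1 b.2) ∧
            ‖logCfg η (gaugeAct u⁻¹ (cutFixed L (tLo a ρ) (tHi a M ρ) U₀ k (ctr a M))) b.1 b.2‖ ≤
              (5 * (d : ℝ) * L * B₀ * ((L : ℝ) ^ 3 * α₀ + 6 * d * (L : ℝ) ^ 2 * M * α₀)) * ((L : ℝ) ^ j * η)⁻¹) ∧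
        (∀ x, ((localGauge L (tLo a ρ) (tHi a M ρ) U₀ k (ctr a M))⁻¹ * u) x ∈ unitaryUnits 𝔸) ∧
        AgreeOn (tlo L (tLo a ρ) k) (thi L (tHi a M ρ) k)
          (gaugeAct ((localGauge L (tLo a ρ) (tHi a M ρ) U₀ k (ctr a M))⁻¹ * u)⁻¹ U₀)
          (gaugeAct u⁻¹ (cutFixed L (tLo a ρ) (tHi a M ρ) U₀ k (ctr a M))) := by
  have hL1 : 1 ≤ L := le_trans (by norm_num) hL
  have hd1 : 1 ≤ d := le_trans (by norm_num) hd2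
  -- common provider threshold and the window threshold of the socket adapters
  set cP : ℝ := min (min cF₀ cF) c59 with hcPdef
  have hcP : 0 < cP := lt_min (lt_min hcF₀ hcF) hc59
  have h₁ : cP ≤ cF₀ := (min_le_left _ _).trans (min_le_left _ _)
  have h₂ : cP ≤ cF := (min_le_left _ _).trans (min_le_right _ _)
  have h₃ : cP ≤ c59 := min_le_right _ _
  obtain ⟨cw, hcw, hwin⟩ := windows4 hd1 hL1 hB₀ hB₀' hB
  have hm₁ : min cP cw ≤ cP := min_le_left _ _
  have hwin' : ∀ α₀ α₁ : ℝ, 0 < α₀ → 0 < α₁ → α₀ + α₁ ≤ min cP cw →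
      8 * B₀' * (5 * (d : ℝ) * L * B₀) * (α₀ + α₁) ≤ 1 / 84 ∧ L * (5 * (d : ℝ) * L * B₀ * (α₀ + α₁)) ≤ 1 / 12 ∧
        α₁ ≤ 1 / 4 ∧ 2 * α₁ ≤ 5 * (d : ℝ) * L * B₀ * (α₀ + α₁) :=
    fun α₀ α₁ hα₀ hα₁ hs => hwin α₀ α₁ hα₀ hα₁ (hs.trans (min_le_right _ _))
  obtain ⟨c₁, hc₁, H⟩ := prop6_exists_cubeMember₃ (𝔸 := 𝔸) hd2 hL hB₀ hB₀' hB (lt_min hcP hcw)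
  refine ⟨c₁, hc₁, ?_⟩
  intro η hη k hk a M ρ hρL hρM hM SHFP₀ SHFP SH59
  exact H η hη k hk a M ρ hρL hρM hM
    (sockP5base_of_sockHFP₀ hd2 hη hL1 hB₀.le hm₁ hwin' (sockHFP₀_anti h₁ SHFP₀))
    (sockP5_of_sockHFP hd2 hη hL1 hB₀.le hm₁ hwin' (sockHFP_anti h₂ SHFP))
    (sockH59_anti (hm₁.trans h₃) SH59)

/-- **PROPOSITION 6 (p. 99) AT THE CONCRETE CUBE MEMBER WITH EXACTLY PRINT'S HYPOTHESES, modulo the THREE existence sockets in the knit's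
currency**: «Let U₀, U₀′, □, □̃ be as described above, and let 7dL²Mα₀ ≤ c₁» — i.e. `U₀` unitary-valued in `𝔄_k({Ω_j}, α₀)` (p. 98),
`□̃ ⊂ Ω_{k−1}` (p. 98; `k ≥ 1`), the cube `□^{(k)} = [a, a + M)ᵈ` with `L ≤ R₁M₁ = ρ ≤ M`, print's implicit `L ≤ dM` and the (1.130)-step condition
`11d < M` (G-B8-14) — THEN «there exists a gauge transformation u defined on □̃» (unitary, `= 1` off `□₀`, (1.29) at the member) «such that
U₀^{w⁻¹} = U₁ = e^{iηA} on □̃, (1.135)» (`AgreeOn` clause with `w = v⁻¹u`) with `A` Hermitian, `Lʲη|A| ≤ 7dL²B₁Mα₀` on the bonds of the plaquettes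
touching `□_j` ((1.136), `|A|` member; `B₁ = 5dLB₀`), in the Landau gauge of record ((1.138)).  ONE threshold `c₁(d, L, B₀, B₀′, cF₀, cF, c59) > 0`;
the tree's (1.130)-regime conditions are absorbed into it (`B8Prop6CubeMember.regime_of_printed_smallness`).  `B8Prop6CubeMember.prop6_asPrinted_cubeMember_of_HFP₄`
WITHOUT the uniqueness socket ∕ conjunct. [cite: Balaban1985RegularSpaces, Prop. 6 (1.135)–(1.138) p.99, p.98, (1.134) p.99] -/
theorem prop6_asPrinted_cubeMember_of_HFP₃ (hd2 : 2 ≤ d) {L : ℕ} (hL : 2 ≤ L) {B₀ B₀' cF₀ cF c59 : ℝ} (hB₀ : 0 < B₀)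
    (hB₀' : 0 < B₀') (hB : 2 ≤ 5 * (d : ℝ) * L * B₀) (hcF₀ : 0 < cF₀) (hcF : 0 < cF) (hc59 : 0 < c59) :
    ∃ c₁ : ℝ, 0 < c₁ ∧ ∀ (η : ℝ), 0 < η → ∀ (k : ℕ), 1 ≤ k → ∀ (a : Site d) (M ρ : ℕ), L ≤ ρ → ρ ≤ M → 11 * (d : ℝ) < M →
      (L : ℝ) ≤ d * M →
      SockHFP₀ (𝔸 := 𝔸) L B₀ B₀' cF₀ η k (cubeFam false L a M ρ k) (cubeLamS L a M ρ k) →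
      SockHFP (𝔸 := 𝔸) L B₀ B₀' cF η k (cubeFam false L a M ρ k) (cubeLamS L a M ρ k) →
      SockH59 (𝔸 := 𝔸) L B₀ B₀' c59 η k (cubeFam false L a M ρ k) (cubeLamS L a M ρ k) (cubeLamB L a M ρ k) →
      ∀ (U₀ : Site d → Fin d → 𝔸ˣ), (∀ x κ, U₀ x κ ∈ unitaryUnits 𝔸) → ∀ (α₀ : ℝ), 0 < α₀ →
      ∀ (Ω : ℕ → Set (Site d)), InAk L k η α₀ Ω U₀ → tcube L a M ρ k ⊆ Ω (k - 1) →
      7 * d * (L : ℝ) ^ 2 * M * α₀ ≤ c₁ →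
      ∃ u : Site d → 𝔸ˣ, (∀ x, u x ∈ unitaryUnits 𝔸) ∧ (∀ x, x ∉ cubeFam false L a M ρ k 0 → u x = 1) ∧
        Restr129 L k (cubeLamS L a M ρ k k) (1 : Site d → Fin d → 𝔸ˣ) u ∧
        IsLandau138W L k η (cubeFam false L a M ρ k 0) (cubeLamS L a M ρ k k) (1 : Site d → Fin d → 𝔸ˣ)
          (gaugeAct u⁻¹ (cutFixed L (tLo a ρ) (tHi a M ρ) U₀ k (ctr a M))) ∧
        (∀ j, j ≤ k → ∀ b ∈ {b : Site d × Fin d | SideTouches (cubeFam false L a M ρ k j) b.1 b.2},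
          gaugeAct u⁻¹ (cutFixed L (tLo a ρ) (tHi a M ρ) U₀ k (ctr a M)) b.1 b.2 =
              cfgExp η (logCfg η (gaugeAct u⁻¹ (cutFixed L (tLo a ρ) (tHi a M ρ) U₀ k (ctr a M)))) b.1 b.2 ∧
            IsSelfAdjoint (logCfg η (gaugeAct u⁻¹ (cutFixed L (tLo a ρ) (tHi a M ρ) U₀ k (ctr a M))) b.1 b.2) ∧
            ‖logCfg η (gaugeAct u⁻¹ (cutFixed L (tLo a ρ) (tHi a M ρ) U₀ k (ctr a M))) b.1 b.2‖ ≤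
              (7 * d * (L : ℝ) ^ 2 * (5 * (d : ℝ) * L * B₀) * M * α₀) * ((L : ℝ) ^ j * η)⁻¹) ∧
        (∀ x, ((localGauge L (tLo a ρ) (tHi a M ρ) U₀ k (ctr a M))⁻¹ * u) x ∈ unitaryUnits 𝔸) ∧
        AgreeOn (tlo L (tLo a ρ) k) (thi L (tHi a M ρ) k)
          (gaugeAct ((localGauge L (tLo a ρ) (tHi a M ρ) U₀ k (ctr a M))⁻¹ * u)⁻¹ U₀)
          (gaugeAct u⁻¹ (cutFixed L (tLo a ρ) (tHi a M ρ) U₀ k (ctr a M))) := by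
  have hL1 : 1 ≤ L := le_trans (by norm_num) hL
  have hd1 : 1 ≤ d := le_trans (by norm_num) hd2
  have hLpos : (0 : ℝ) < L := by exact_mod_cast lt_of_lt_of_le (by norm_num) hL
  have hC0 := C0_pos d
  have hc2 := c2'_pos d L hL1
  obtain ⟨c₀, hc₀, H⟩ := prop6_exists_cubeMember_of_HFP₃ (𝔸 := 𝔸) hd2 hL hB₀ hB₀' hB hcF₀ hcF hc59
  -- the threshold: the driver's, capped so that «7dL²Mα₀ ≤ c₁» also yields the tree's (1.130)-regime conditions
  refine ⟨min c₀ (min (7 / (3 * C0 d)) (min (7 * c2' d L / 2) (7 / 36))), ?_, ?_⟩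
  · exact lt_min hc₀ (lt_min (by positivity) (lt_min (by positivity) (by norm_num)))
  intro η hη k hk a M ρ hρL hρM hM hLdM SHFP₀ SHFP SH59 U₀ hU₀ α₀ hα Ω hA hT hc
  have hρ : 1 ≤ ρ := hL1.trans hρL
  have hM1 : 1 ≤ M := hρ.trans hρM
  have hc' : 7 * d * (L : ℝ) ^ 2 * M * α₀ ≤ c₀ := hc.trans (min_le_left _ _)
  have hcA : 7 * d * (L : ℝ) ^ 2 * M * α₀ ≤ min (7 / (3 * C0 d)) (min (7 * c2' d L / 2) (7 / 36)) := hc.trans (min_le_right _ _)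
  obtain ⟨hα3, hα2, hsmall⟩ := regime_of_printed_smallness (L := L) hd1 hM1 hρM hM hα hcA (min_le_left _ _)
    ((min_le_right _ _).trans (min_le_left _ _)) ((min_le_right _ _).trans (min_le_right _ _))
  have hB₁ : 0 ≤ 5 * (d : ℝ) * L * B₀ := by positivity
  obtain ⟨u, hu, huS, h129, hLan, h162, hw, h135⟩ := H η hη k hk a M ρ hρL hρM hM SHFP₀ SHFP SH59 U₀ hU₀ α₀ hα
    hα3 hα2 Ω hA hT hsmall (smallness_134 hLpos hα hLdM hc')
  refine ⟨u, hu, huS, h129, hLan, fun j hj b hb => ?_, hw, h135⟩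
  obtain ⟨h1, h2, h3⟩ := h162 j hj b hb
  refine ⟨h1, h2, h3.trans ?_⟩
  have hη0 : 0 ≤ ((L : ℝ) ^ j * η)⁻¹ := by positivity
  exact mul_le_mul_of_nonneg_right (const_136 hLpos hα hB₁ hLdM) hη0

end Prop6

#print axioms thm4Exists_concrete_uniform
#print axioms prop6_exists_cubeMember₃
#print axioms prop6_asPrinted_cubeMember_of_HFP₃

end Literature.MathematicalPhysics.QuantumFieldTheory.Balaban1983to89.B8Prop6CubeMemberExists

end
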